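import Summits.AtomisticToContinuum.HydrodynamicLimit.Theorems.ImplosionDichotomyPolynomialCompressionShadowRegularity
import Summits.AtomisticToContinuum.HydrodynamicLimit.Theorems.ImplosionDichotomyPolynomialCompressionBootstrap
import Literature.Analysis.FunctionSpaces.TorusSpaceTimeComposition

/-!
# Closing of stub 4: the continuous induction

Helper file for the line `log-lipschitz-budget` of the crux `ImplosionDichotomy.PolynomialCompression`
(stmt-AtomisticToContinuum-12587), stub `stub_logBudgetShadowing`, the CLOSE. The bootstrap principle
`bootstrap_of_continuousOn` is run on the sixteen continuous quantities of the shadowing estimate — the sup norms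
of `δρ/ρ₁`, `δθ/θ₁`, `σ³ρ`, `δu`, of `∂ᵢδu`, `√θ₁ ∂ᵢδρ/ρ₁`, `∂ᵢδθ/√θ₁` (`i ≤ 3`), and the level energies
`√E₁, √E₂, √E₃` — against the barriers `1/4, 1/4, η_s/2, 1, 1/(2(T₁ - s)), σ³ Q_k (T₁/(T₁ - s))^{b_k}`:
if the STRONG bounds hold at `t = 0` and the WEAK bounds on `[0, t]` imply the STRONG bounds at `t`
(the improvement step `pcClose_step`, entering as the hypothesis `hstep`), then the STRONG bounds hold on
`[0, T')`. Continuity in time of the sup norms is `shadow_sup_continuous(_vec)`, of the energies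
`continuousOn_shadowEk`.
-/

noncomputable section

namespace Summit.AtomisticToContinuum.HydrodynamicLimit.Theorems

open Set Filter Topology MeasureTheory
open scoped ContDiff ENNReal
open Literature.MathematicalPhysics.KineticTheory Literature.Analysis.FunctionSpaces

/-- The sup norm of a jointly smooth scalar field as an abstract continuous dominating function.
[folklore] -/
private theorem sup_pkg {T' : ℝ} {φ : ℝ → T3 → ℝ} (h : Torus.IsSmoothSpaceTimeOn (Ico 0 T') φ) :
    ∃ g : ℝ → ℝ, ContinuousOn g (Ico 0 T') ∧ (∀ s ∈ Ico 0 T', ∀ x, |φ s x| ≤ g s) ∧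
      ∀ (s M : ℝ), 0 ≤ M → (∀ x, |φ s x| ≤ M) → g s ≤ M :=
  ⟨_, shadow_sup_continuous h⟩

/-- The sup norm of a jointly smooth vector field as an abstract continuous dominating function.
[folklore] -/
private theorem sup_pkg_vec {T' : ℝ} {w : ℝ → T3 → V3} (h : Torus.IsSmoothSpaceTimeOn (Ico 0 T') w) :
    ∃ g : ℝ → ℝ, ContinuousOn g (Ico 0 T') ∧ (∀ s ∈ Ico 0 T', ∀ x, ‖w s x‖ ≤ g s) ∧
      ∀ (s M : ℝ), 0 ≤ M → (∀ x, ‖w s x‖ ≤ M) → g s ≤ M :=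
  ⟨_, shadow_sup_continuous_vec h⟩

/-- `|a b / c| = a |b| / c` for `a ≥ 0`, `c > 0`. [folklore] -/
private theorem abs_mul_div_eq {a b c : ℝ} (ha : 0 ≤ a) (hc : 0 < c) : |a * b / c| = a * |b| / c := by
  rw [abs_div, abs_mul, abs_of_nonneg ha, abs_of_pos hc]

/-- `|b / a| = |b| / a` for `a > 0`. [folklore] -/
private theorem abs_div_eq {a b : ℝ} (ha : 0 < a) : |b / a| = |b| / a := by
  rw [abs_div, abs_of_pos ha]

/-- **The continuous induction of the close.** See the module docstring. [folklore] -/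
theorem pcClose_bootstrap :
    ∀ {σ T' T₁ ηs Q₁ b₁ Q₂ b₂ Q₃ b₃ : ℝ} {ρ θ ρ₁ θ₁ : ℝ → T3 → ℝ} {u u₁ : ℝ → T3 → V3} {ζ : ℝ → ℝ}
      {J : Set ℝ},
      IsHardSphereEulerSolution σ T' ρ u θ → IsHardSphereEulerSolution 0 T' ρ₁ u₁ θ₁ → IsOpen J →
      ContDiffOn ℝ (⊤ : ℕ∞) ζ J → (∀ t ∈ Ico 0 T', ∀ x, ρ t x ∈ J) → T' ≤ T₁ → 0 < σ → 0 < ηs →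
      0 < Q₁ → 0 < Q₂ → 0 < Q₃ →
      ((∀ x, |ρ 0 x - ρ₁ 0 x| ≤ ρ₁ 0 x / 4 ∧ |θ 0 x - θ₁ 0 x| ≤ θ₁ 0 x / 4 ∧
          ρ 0 x * σ ^ 3 ≤ ηs / 2 ∧ ‖u 0 x - u₁ 0 x‖ ≤ 1 ∧
          ∀ i : Fin 3,
            ‖Torus.partialDeriv i (u 0) x - Torus.partialDeriv i (u₁ 0) x‖ ≤ 1 / (2 * (T₁ - 0)) ∧
            Real.sqrt (θ₁ 0 x) * |Torus.partialDeriv i (ρ 0) x - Torus.partialDeriv i (ρ₁ 0) x| /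
                ρ₁ 0 x ≤ 1 / (2 * (T₁ - 0)) ∧
            |Torus.partialDeriv i (θ 0) x - Torus.partialDeriv i (θ₁ 0) x| / Real.sqrt (θ₁ 0 x) ≤
              1 / (2 * (T₁ - 0))) ∧
        Real.sqrt (shadowE1 ζ ρ θ u ρ₁ θ₁ u₁ 0) ≤ σ ^ 3 * Q₁ * (T₁ / (T₁ - 0)) ^ b₁ ∧
        Real.sqrt (shadowE2 ζ ρ θ u ρ₁ θ₁ u₁ 0) ≤ σ ^ 3 * Q₂ * (T₁ / (T₁ - 0)) ^ b₂ ∧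
        Real.sqrt (shadowE3 ζ ρ θ u ρ₁ θ₁ u₁ 0) ≤ σ ^ 3 * Q₃ * (T₁ / (T₁ - 0)) ^ b₃) →
      (∀ t ∈ Ico 0 T', ShadowWeakBootstrap 1 ηs T₁ σ ρ θ u ρ₁ θ₁ u₁ t →
        (∀ s ∈ Icc 0 t, Real.sqrt (shadowE1 ζ ρ θ u ρ₁ θ₁ u₁ s) ≤ 2 * (σ ^ 3 * Q₁ * (T₁ / (T₁ - s)) ^ b₁) ∧
          Real.sqrt (shadowE2 ζ ρ θ u ρ₁ θ₁ u₁ s) ≤ 2 * (σ ^ 3 * Q₂ * (T₁ / (T₁ - s)) ^ b₂) ∧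
          Real.sqrt (shadowE3 ζ ρ θ u ρ₁ θ₁ u₁ s) ≤ 2 * (σ ^ 3 * Q₃ * (T₁ / (T₁ - s)) ^ b₃)) →
        (∀ x, |ρ t x - ρ₁ t x| ≤ ρ₁ t x / 4 ∧ |θ t x - θ₁ t x| ≤ θ₁ t x / 4 ∧
            ρ t x * σ ^ 3 ≤ ηs / 2 ∧ ‖u t x - u₁ t x‖ ≤ 1 ∧
            ∀ i : Fin 3,
              ‖Torus.partialDeriv i (u t) x - Torus.partialDeriv i (u₁ t) x‖ ≤ 1 / (2 * (T₁ - t)) ∧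
              Real.sqrt (θ₁ t x) * |Torus.partialDeriv i (ρ t) x - Torus.partialDeriv i (ρ₁ t) x| /
                  ρ₁ t x ≤ 1 / (2 * (T₁ - t)) ∧
              |Torus.partialDeriv i (θ t) x - Torus.partialDeriv i (θ₁ t) x| / Real.sqrt (θ₁ t x) ≤
                1 / (2 * (T₁ - t))) ∧
          Real.sqrt (shadowE1 ζ ρ θ u ρ₁ θ₁ u₁ t) ≤ σ ^ 3 * Q₁ * (T₁ / (T₁ - t)) ^ b₁ ∧
          Real.sqrt (shadowE2 ζ ρ θ u ρ₁ θ₁ u₁ t) ≤ σ ^ 3 * Q₂ * (T₁ / (T₁ - t)) ^ b₂ ∧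
          Real.sqrt (shadowE3 ζ ρ θ u ρ₁ θ₁ u₁ t) ≤ σ ^ 3 * Q₃ * (T₁ / (T₁ - t)) ^ b₃) →
      ∀ t ∈ Ico 0 T',
        (∀ x, |ρ t x - ρ₁ t x| ≤ ρ₁ t x / 4 ∧ |θ t x - θ₁ t x| ≤ θ₁ t x / 4 ∧
            ρ t x * σ ^ 3 ≤ ηs / 2 ∧ ‖u t x - u₁ t x‖ ≤ 1 ∧
            ∀ i : Fin 3,
              ‖Torus.partialDeriv i (u t) x - Torus.partialDeriv i (u₁ t) x‖ ≤ 1 / (2 * (T₁ - t)) ∧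
              Real.sqrt (θ₁ t x) * |Torus.partialDeriv i (ρ t) x - Torus.partialDeriv i (ρ₁ t) x| /
                  ρ₁ t x ≤ 1 / (2 * (T₁ - t)) ∧
              |Torus.partialDeriv i (θ t) x - Torus.partialDeriv i (θ₁ t) x| / Real.sqrt (θ₁ t x) ≤
                1 / (2 * (T₁ - t))) ∧
          Real.sqrt (shadowE1 ζ ρ θ u ρ₁ θ₁ u₁ t) ≤ σ ^ 3 * Q₁ * (T₁ / (T₁ - t)) ^ b₁ ∧
          Real.sqrt (shadowE2 ζ ρ θ u ρ₁ θ₁ u₁ t) ≤ σ ^ 3 * Q₂ * (T₁ / (T₁ - t)) ^ b₂ ∧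
          Real.sqrt (shadowE3 ζ ρ θ u ρ₁ θ₁ u₁ t) ≤ σ ^ 3 * Q₃ * (T₁ / (T₁ - t)) ^ b₃ := by
  intro σ T' T₁ ηs Q₁ b₁ Q₂ b₂ Q₃ b₃ ρ θ ρ₁ θ₁ u u₁ ζ J hE hE₁ hJ hζ hρJ hT hσ hηs hQ₁ hQ₂ hQ₃ hinit hstep t ht
  have hT'0 : 0 < T' := ht.1.trans_lt ht.2
  have h0 : (0 : ℝ) ∈ Ico 0 T' := ⟨le_rfl, hT'0⟩
  have hUD : UniqueDiffOn ℝ (Ico 0 T') := uniqueDiffOn_Ico 0 T'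
  have hpos₁ : ∀ s ∈ Ico 0 T', ∀ x, 0 < ρ₁ s x := hE₁.density_pos
  have hθpos₁ : ∀ s ∈ Ico 0 T', ∀ x, 0 < θ₁ s x := hE₁.temperature_pos
  have hlapse : ∀ s ∈ Ico 0 T', 0 < T₁ - s := fun s hs => sub_pos.2 (hs.2.trans_le hT)
  have hT₁ : 0 < T₁ := hT'0.trans_le hT
  -- joint smoothness of the sixteen fields
  have hsρ := hE.smooth_density
  have hsθ := hE.smooth_temperature
  have hsu := hE.smooth_velocity
  have hsρ₁ := hE₁.smooth_density
  have hsθ₁ := hE₁.smooth_temperature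
  have hsu₁ := hE₁.smooth_velocity
  have hsq : Torus.IsSmoothSpaceTimeOn (Ico 0 T') (fun s x => Real.sqrt (θ₁ s x)) := hsθ₁.sqrt hθpos₁
  have hsm0 : Torus.IsSmoothSpaceTimeOn (Ico 0 T') (fun s x => (ρ s x - ρ₁ s x) / ρ₁ s x) := by
    refine ContDiffOn.div (hsρ.sub hsρ₁) hsρ₁ ?_
    rintro ⟨s, v⟩ hp
    exact (hpos₁ s (mem_prod.1 hp).1 _).ne'
  have hsm1 : Torus.IsSmoothSpaceTimeOn (Ico 0 T') (fun s x => (θ s x - θ₁ s x) / θ₁ s x) := by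
    refine ContDiffOn.div (hsθ.sub hsθ₁) hsθ₁ ?_
    rintro ⟨s, v⟩ hp
    exact (hθpos₁ s (mem_prod.1 hp).1 _).ne'
  have hsm2 : Torus.IsSmoothSpaceTimeOn (Ico 0 T') (fun s x => σ ^ 3 * ρ s x) :=
    isSmoothSpaceTimeOn_const_mul hsρ (σ ^ 3)
  have hsm3 : Torus.IsSmoothSpaceTimeOn (Ico 0 T') (fun s x => u s x - u₁ s x) := hsu.sub hsu₁
  have hsmU : ∀ i : Fin 3, Torus.IsSmoothSpaceTimeOn (Ico 0 T')
      (fun s x => Torus.partialDeriv i (u s) x - Torus.partialDeriv i (u₁ s) x) := fun i =>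
    (hsu.partialDeriv hUD i).sub (hsu₁.partialDeriv hUD i)
  have hsmR : ∀ i : Fin 3, Torus.IsSmoothSpaceTimeOn (Ico 0 T')
      (fun s x => Real.sqrt (θ₁ s x) * (Torus.partialDeriv i (ρ s) x - Torus.partialDeriv i (ρ₁ s) x) /
        ρ₁ s x) := by
    intro i
    refine ContDiffOn.div (hsq.mul ((hsρ.partialDeriv hUD i).sub (hsρ₁.partialDeriv hUD i))) hsρ₁ ?_
    rintro ⟨s, v⟩ hp
    exact (hpos₁ s (mem_prod.1 hp).1 _).ne'
  have hsmT : ∀ i : Fin 3, Torus.IsSmoothSpaceTimeOn (Ico 0 T')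
      (fun s x => (Torus.partialDeriv i (θ s) x - Torus.partialDeriv i (θ₁ s) x) / Real.sqrt (θ₁ s x)) := by
    intro i
    refine ContDiffOn.div ((hsθ.partialDeriv hUD i).sub (hsθ₁.partialDeriv hUD i)) hsq ?_
    rintro ⟨s, v⟩ hp
    exact (Real.sqrt_pos.2 (hθpos₁ s (mem_prod.1 hp).1 _)).ne'
  -- the sup norms as continuous dominating functions
  obtain ⟨g0, hc0, hd0, hl0⟩ := sup_pkg hsm0
  obtain ⟨g1, hc1, hd1, hl1⟩ := sup_pkg hsm1
  obtain ⟨g2, hc2, hd2, hl2⟩ := sup_pkg hsm2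
  obtain ⟨g3, hc3, hd3, hl3⟩ := sup_pkg_vec hsm3
  choose gU hcU hdU hlU using fun i => sup_pkg_vec (hsmU i)
  choose gR hcR hdR hlR using fun i => sup_pkg (hsmR i)
  choose gT hcT hdT hlT using fun i => sup_pkg (hsmT i)
  -- the energies
  have hcE1 : ContinuousOn (fun s => Real.sqrt (shadowE1 ζ ρ θ u ρ₁ θ₁ u₁ s)) (Ico 0 T') :=
    Real.continuous_sqrt.comp_continuousOn (continuousOn_shadowE1 hE hE₁ hJ hζ hρJ)
  have hcE2 : ContinuousOn (fun s => Real.sqrt (shadowE2 ζ ρ θ u ρ₁ θ₁ u₁ s)) (Ico 0 T') :=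
    Real.continuous_sqrt.comp_continuousOn (continuousOn_shadowE2 hE hE₁ hJ hζ hρJ)
  have hcE3 : ContinuousOn (fun s => Real.sqrt (shadowE3 ζ ρ θ u ρ₁ θ₁ u₁ s)) (Ico 0 T') :=
    Real.continuous_sqrt.comp_continuousOn (continuousOn_shadowE3 hE hE₁ hJ hζ hρJ)
  -- the barriers
  have hcX : ContinuousOn (fun s : ℝ => T₁ / (T₁ - s)) (Ico 0 T') :=
    continuousOn_const.div (continuousOn_const.sub continuousOn_id) fun s hs => (hlapse s hs).ne'
  have hXpos : ∀ s ∈ Ico 0 T', 0 < T₁ / (T₁ - s) := fun s hs => div_pos hT₁ (hlapse s hs)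
  have hcB : ∀ Q b : ℝ, ContinuousOn (fun s : ℝ => σ ^ 3 * Q * (T₁ / (T₁ - s)) ^ b) (Ico 0 T') :=
    fun Q b => continuousOn_const.mul (hcX.rpow_const fun s hs => Or.inl (hXpos s hs).ne')
  have hBpos : ∀ {Q b : ℝ}, 0 < Q → ∀ s ∈ Ico 0 T', 0 < σ ^ 3 * Q * (T₁ / (T₁ - s)) ^ b :=
    fun hQ s hs => mul_pos (mul_pos (pow_pos hσ 3) hQ) (Real.rpow_pos_of_pos (hXpos s hs) _)
  have hcD : ContinuousOn (fun s : ℝ => 1 / (2 * (T₁ - s))) (Ico 0 T') :=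
    continuousOn_const.div (continuousOn_const.mul (continuousOn_const.sub continuousOn_id))
      fun s hs => (mul_pos two_pos (hlapse s hs)).ne'
  have hDpos : ∀ s ∈ Ico 0 T', 0 < 1 / (2 * (T₁ - s)) := fun s hs =>
    div_pos one_pos (mul_pos two_pos (hlapse s hs))
  -- STRONG at `s` gives the barrier bounds at `s`
  have hconv : ∀ s ∈ Ico 0 T',
      ((∀ x, |ρ s x - ρ₁ s x| ≤ ρ₁ s x / 4 ∧ |θ s x - θ₁ s x| ≤ θ₁ s x / 4 ∧
          ρ s x * σ ^ 3 ≤ ηs / 2 ∧ ‖u s x - u₁ s x‖ ≤ 1 ∧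
          ∀ i : Fin 3,
            ‖Torus.partialDeriv i (u s) x - Torus.partialDeriv i (u₁ s) x‖ ≤ 1 / (2 * (T₁ - s)) ∧
            Real.sqrt (θ₁ s x) * |Torus.partialDeriv i (ρ s) x - Torus.partialDeriv i (ρ₁ s) x| /
                ρ₁ s x ≤ 1 / (2 * (T₁ - s)) ∧
            |Torus.partialDeriv i (θ s) x - Torus.partialDeriv i (θ₁ s) x| / Real.sqrt (θ₁ s x) ≤
              1 / (2 * (T₁ - s))) ∧
        Real.sqrt (shadowE1 ζ ρ θ u ρ₁ θ₁ u₁ s) ≤ σ ^ 3 * Q₁ * (T₁ / (T₁ - s)) ^ b₁ ∧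
        Real.sqrt (shadowE2 ζ ρ θ u ρ₁ θ₁ u₁ s) ≤ σ ^ 3 * Q₂ * (T₁ / (T₁ - s)) ^ b₂ ∧
        Real.sqrt (shadowE3 ζ ρ θ u ρ₁ θ₁ u₁ s) ≤ σ ^ 3 * Q₃ * (T₁ / (T₁ - s)) ^ b₃) →
      g0 s ≤ 1 / 4 ∧ g1 s ≤ 1 / 4 ∧ g2 s ≤ ηs / 2 ∧ g3 s ≤ 1 ∧
        (∀ i, gU i s ≤ 1 / (2 * (T₁ - s)) ∧ gR i s ≤ 1 / (2 * (T₁ - s)) ∧ gT i s ≤ 1 / (2 * (T₁ - s))) ∧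
        Real.sqrt (shadowE1 ζ ρ θ u ρ₁ θ₁ u₁ s) ≤ σ ^ 3 * Q₁ * (T₁ / (T₁ - s)) ^ b₁ ∧
        Real.sqrt (shadowE2 ζ ρ θ u ρ₁ θ₁ u₁ s) ≤ σ ^ 3 * Q₂ * (T₁ / (T₁ - s)) ^ b₂ ∧
        Real.sqrt (shadowE3 ζ ρ θ u ρ₁ θ₁ u₁ s) ≤ σ ^ 3 * Q₃ * (T₁ / (T₁ - s)) ^ b₃ := by
    intro s hs hS
    obtain ⟨hpt, e1, e2, e3⟩ := hS
    have hDn : 0 ≤ 1 / (2 * (T₁ - s)) := (hDpos s hs).le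
    refine ⟨?_, ?_, ?_, ?_, fun i => ⟨?_, ?_, ?_⟩, e1, e2, e3⟩
    · refine hl0 s _ (by norm_num) fun x => ?_
      have hρ₁ := hpos₁ s hs x
      rw [abs_div_eq hρ₁, div_le_iff₀ hρ₁]
      linarith [(hpt x).1]
    · refine hl1 s _ (by norm_num) fun x => ?_
      have hθ₁ := hθpos₁ s hs x
      rw [abs_div_eq hθ₁, div_le_iff₀ hθ₁]
      linarith [(hpt x).2.1]
    · refine hl2 s _ (by linarith) fun x => ?_
      have h := (hpt x).2.2.1
      have hρ := (hE.density_pos s hs x).le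
      rw [abs_of_nonneg (by positivity)]
      linarith [mul_comm (ρ s x) (σ ^ 3)]
    · exact hl3 s _ zero_le_one fun x => (hpt x).2.2.2.1
    · exact hlU i s _ hDn fun x => ((hpt x).2.2.2.2 i).1
    · refine hlR i s _ hDn fun x => ?_
      rw [abs_mul_div_eq (Real.sqrt_nonneg _) (hpos₁ s hs x)]
      exact ((hpt x).2.2.2.2 i).2.1
    · refine hlT i s _ hDn fun x => ?_
      rw [abs_div_eq (Real.sqrt_pos.2 (hθpos₁ s hs x))]
      exact ((hpt x).2.2.2.2 i).2.2
  -- the barrier bounds (weak, factor 2) on `[0, t]` give WEAK on `[0, t]`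
  have hweak_of : ∀ t ∈ Ico 0 T',
      (∀ s ∈ Icc 0 t, g0 s ≤ 2 * (1 / 4) ∧ g1 s ≤ 2 * (1 / 4) ∧ g2 s ≤ 2 * (ηs / 2) ∧
        (∀ i, gU i s ≤ 2 * (1 / (2 * (T₁ - s))) ∧ gR i s ≤ 2 * (1 / (2 * (T₁ - s))) ∧
          gT i s ≤ 2 * (1 / (2 * (T₁ - s)))) ∧
        Real.sqrt (shadowE1 ζ ρ θ u ρ₁ θ₁ u₁ s) ≤ 2 * (σ ^ 3 * Q₁ * (T₁ / (T₁ - s)) ^ b₁) ∧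
        Real.sqrt (shadowE2 ζ ρ θ u ρ₁ θ₁ u₁ s) ≤ 2 * (σ ^ 3 * Q₂ * (T₁ / (T₁ - s)) ^ b₂) ∧
        Real.sqrt (shadowE3 ζ ρ θ u ρ₁ θ₁ u₁ s) ≤ 2 * (σ ^ 3 * Q₃ * (T₁ / (T₁ - s)) ^ b₃)) →
      ShadowWeakBootstrap 1 ηs T₁ σ ρ θ u ρ₁ θ₁ u₁ t ∧
        ∀ s ∈ Icc 0 t, Real.sqrt (shadowE1 ζ ρ θ u ρ₁ θ₁ u₁ s) ≤ 2 * (σ ^ 3 * Q₁ * (T₁ / (T₁ - s)) ^ b₁) ∧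
          Real.sqrt (shadowE2 ζ ρ θ u ρ₁ θ₁ u₁ s) ≤ 2 * (σ ^ 3 * Q₂ * (T₁ / (T₁ - s)) ^ b₂) ∧
          Real.sqrt (shadowE3 ζ ρ θ u ρ₁ θ₁ u₁ s) ≤ 2 * (σ ^ 3 * Q₃ * (T₁ / (T₁ - s)) ^ b₃) := by
    intro t ht hall
    have hts : ∀ s ∈ Icc 0 t, s ∈ Ico 0 T' := fun s hs => ⟨hs.1, hs.2.trans_lt ht.2⟩
    refine ⟨⟨fun s hs x => ?_, fun s hs x i => ?_⟩, fun s hs => (hall s hs).2.2.2.2⟩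
    · have hsT := hts s hs
      obtain ⟨a0, a1, a2, -⟩ := hall s hs
      have hρ₁ := hpos₁ s hsT x
      have hθ₁ := hθpos₁ s hsT x
      have b0 := (hd0 s hsT x).trans a0
      have b1 := (hd1 s hsT x).trans a1
      have b2 := (hd2 s hsT x).trans a2
      rw [abs_div_eq hρ₁, div_le_iff₀ hρ₁] at b0
      rw [abs_div_eq hθ₁, div_le_iff₀ hθ₁] at b1
      have hρ := (hE.density_pos s hsT x).le
      rw [abs_of_nonneg (by positivity)] at b2
      refine ⟨by linarith, by linarith, by linarith [mul_comm (ρ s x) (σ ^ 3)]⟩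
    · have hsT := hts s hs
      obtain ⟨-, -, -, aD, -⟩ := hall s hs
      obtain ⟨aU, aR, aT⟩ := aD i
      have hl := hlapse s hsT
      have e2 : 2 * (1 / (2 * (T₁ - s))) = 1 / (T₁ - s) := by field_simp
      have bU := (hdU i s hsT x).trans aU
      have bR := (hdR i s hsT x).trans aR
      have bT := (hdT i s hsT x).trans aT
      rw [e2] at bU bR bT
      rw [abs_mul_div_eq (Real.sqrt_nonneg _) (hpos₁ s hsT x)] at bR
      rw [abs_div_eq (Real.sqrt_pos.2 (hθpos₁ s hsT x))] at bT
      exact ⟨bU, bR, bT⟩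
  -- the continuous induction
  have hrun := bootstrap_of_continuousOn (ι := Fin 7 ⊕ Fin 3 × Fin 3) (T := T')
    (g := Sum.elim ![g0, g1, g2, g3, fun s => Real.sqrt (shadowE1 ζ ρ θ u ρ₁ θ₁ u₁ s),
        fun s => Real.sqrt (shadowE2 ζ ρ θ u ρ₁ θ₁ u₁ s), fun s => Real.sqrt (shadowE3 ζ ρ θ u ρ₁ θ₁ u₁ s)]
      (fun p => ![gU p.1, gR p.1, gT p.1] p.2))
    (b := Sum.elim ![fun _ => 1 / 4, fun _ => 1 / 4, fun _ => ηs / 2, fun _ => 1,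
        fun s => σ ^ 3 * Q₁ * (T₁ / (T₁ - s)) ^ b₁, fun s => σ ^ 3 * Q₂ * (T₁ / (T₁ - s)) ^ b₂,
        fun s => σ ^ 3 * Q₃ * (T₁ / (T₁ - s)) ^ b₃]
      (fun _ s => 1 / (2 * (T₁ - s)))) ?_ ?_ ?_ ?_ ?_
  · -- conclusion: WEAK on `[0, t]` from the run, then the step once more
    have hall : ∀ s ∈ Icc 0 t, g0 s ≤ 2 * (1 / 4) ∧ g1 s ≤ 2 * (1 / 4) ∧ g2 s ≤ 2 * (ηs / 2) ∧
        (∀ i, gU i s ≤ 2 * (1 / (2 * (T₁ - s))) ∧ gR i s ≤ 2 * (1 / (2 * (T₁ - s))) ∧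
          gT i s ≤ 2 * (1 / (2 * (T₁ - s)))) ∧
        Real.sqrt (shadowE1 ζ ρ θ u ρ₁ θ₁ u₁ s) ≤ 2 * (σ ^ 3 * Q₁ * (T₁ / (T₁ - s)) ^ b₁) ∧
        Real.sqrt (shadowE2 ζ ρ θ u ρ₁ θ₁ u₁ s) ≤ 2 * (σ ^ 3 * Q₂ * (T₁ / (T₁ - s)) ^ b₂) ∧
        Real.sqrt (shadowE3 ζ ρ θ u ρ₁ θ₁ u₁ s) ≤ 2 * (σ ^ 3 * Q₃ * (T₁ / (T₁ - s)) ^ b₃) := by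
      intro s hs
      have hsT : s ∈ Ico 0 T' := ⟨hs.1, hs.2.trans_lt ht.2⟩
      have two : ∀ {a c : ℝ}, a ≤ c → 0 < c → a ≤ 2 * c := fun h hc => by linarith
      refine ⟨two (hrun (Sum.inl 0) s hsT) (by norm_num), two (hrun (Sum.inl 1) s hsT) (by norm_num),
        two (hrun (Sum.inl 2) s hsT) (by linarith), fun i => ⟨two (hrun (Sum.inr (i, 0)) s hsT) (hDpos s hsT),
          two (hrun (Sum.inr (i, 1)) s hsT) (hDpos s hsT), two (hrun (Sum.inr (i, 2)) s hsT) (hDpos s hsT)⟩,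
        two (hrun (Sum.inl 4) s hsT) (hBpos hQ₁ s hsT), two (hrun (Sum.inl 5) s hsT) (hBpos hQ₂ s hsT),
        two (hrun (Sum.inl 6) s hsT) (hBpos hQ₃ s hsT)⟩
    obtain ⟨hw, hwE⟩ := hweak_of t ht hall
    exact hstep t ht hw hwE
  · -- continuity of the quantities
    rintro (i | ⟨i, j⟩)
    · fin_cases i
      exacts [hc0, hc1, hc2, hc3, hcE1, hcE2, hcE3]
    · fin_cases j
      exacts [hcU i, hcR i, hcT i]
  · -- continuity of the barriers
    rintro (i | ⟨i, j⟩)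
    · fin_cases i
      exacts [continuousOn_const, continuousOn_const, continuousOn_const, continuousOn_const, hcB Q₁ b₁,
        hcB Q₂ b₂, hcB Q₃ b₃]
    · exact hcD
  · -- positivity of the barriers
    rintro (i | ⟨i, j⟩) s hs
    · fin_cases i
      exacts [by norm_num, by norm_num, by show 0 < ηs / 2; linarith, zero_lt_one, hBpos hQ₁ s hs,
        hBpos hQ₂ s hs, hBpos hQ₃ s hs]
    · exact hDpos s hs
  · -- the bounds at `t = 0`
    obtain ⟨c0, c1, c2, c3, cD, cE1, cE2, cE3⟩ := hconv 0 h0 hinit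
    rintro (i | ⟨i, j⟩)
    · fin_cases i
      exacts [c0, c1, c2, c3, cE1, cE2, cE3]
    · fin_cases j
      exacts [(cD i).1, (cD i).2.1, (cD i).2.2]
  · -- the improvement step
    intro s hs hall
    have hall' : ∀ r ∈ Icc 0 s, g0 r ≤ 2 * (1 / 4) ∧ g1 r ≤ 2 * (1 / 4) ∧ g2 r ≤ 2 * (ηs / 2) ∧
        (∀ i, gU i r ≤ 2 * (1 / (2 * (T₁ - r))) ∧ gR i r ≤ 2 * (1 / (2 * (T₁ - r))) ∧
          gT i r ≤ 2 * (1 / (2 * (T₁ - r)))) ∧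
        Real.sqrt (shadowE1 ζ ρ θ u ρ₁ θ₁ u₁ r) ≤ 2 * (σ ^ 3 * Q₁ * (T₁ / (T₁ - r)) ^ b₁) ∧
        Real.sqrt (shadowE2 ζ ρ θ u ρ₁ θ₁ u₁ r) ≤ 2 * (σ ^ 3 * Q₂ * (T₁ / (T₁ - r)) ^ b₂) ∧
        Real.sqrt (shadowE3 ζ ρ θ u ρ₁ θ₁ u₁ r) ≤ 2 * (σ ^ 3 * Q₃ * (T₁ / (T₁ - r)) ^ b₃) :=
      fun r hr => ⟨hall (Sum.inl 0) r hr, hall (Sum.inl 1) r hr, hall (Sum.inl 2) r hr,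
        fun i => ⟨hall (Sum.inr (i, 0)) r hr, hall (Sum.inr (i, 1)) r hr, hall (Sum.inr (i, 2)) r hr⟩,
        hall (Sum.inl 4) r hr, hall (Sum.inl 5) r hr, hall (Sum.inl 6) r hr⟩
    obtain ⟨hw, hwE⟩ := hweak_of s hs hall'
    obtain ⟨c0, c1, c2, c3, cD, cE1, cE2, cE3⟩ := hconv s hs (hstep s hs hw hwE)
    rintro (i | ⟨i, j⟩)
    · fin_cases i
      exacts [c0, c1, c2, c3, cE1, cE2, cE3]
    · fin_cases j
      exacts [(cD i).1, (cD i).2.1, (cD i).2.2]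

end Summit.AtomisticToContinuum.HydrodynamicLimit.Theorems

end
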